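import Mathlib
import Summits.Ventures.PercRepro2.Defs
import Summits.Ventures.PercRepro2.Graph
import Summits.Ventures.PercRepro2.OneColourSwitch
import Summits.Ventures.PercRepro2.M9NoPocketDefs
import Summits.Ventures.PercRepro2.M9GeneralDSplit
import Summits.Ventures.PercRepro2.M9GeneralDHD
import Summits.Ventures.PercRepro2.M9PocketUnitFibreSum
import Summits.Ventures.PercRepro2.M9PocketUnitKonly
import Summits.Ventures.PercRepro2.M9PocketProdHarris
import Summits.Ventures.PercRepro2.M9PocketProdPoint
import Summits.Ventures.PercRepro2.M9PocketProdWorlds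
import Summits.Ventures.PercRepro2.M9PocketProdMono
import Summits.Ventures.PercRepro2.M9PocketProdSum
import Summits.Ventures.PercRepro2.M9PocketProdSkel
import Summits.Ventures.PercRepro2.M9PocketProdFam
import Summits.Ventures.PercRepro2.M9PocketProdPartition
import Summits.Ventures.PercRepro2.M9PocketProdWsideFam
import Summits.Ventures.PercRepro2.M9PocketProdAssembly
import Summits.Ventures.PercRepro2.M9PocketUnitFibreSumT
import Summits.Ventures.PercRepro2.M9PocketProdPointT
import Summits.Ventures.PercRepro2.M9PocketProdWorldsT
import Summits.Ventures.PercRepro2.M9PocketProdMonoT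
import Summits.Ventures.PercRepro2.M9PocketProdHDT
import Summits.Ventures.PercRepro2.M9PocketProdLinkT
import Summits.Ventures.PercRepro2.M9PocketProdSumT
import Summits.Ventures.PercRepro2.M9PocketProdSkelT
import Summits.Ventures.PercRepro2.M9PocketProdPartitionT
import Summits.Ventures.PercRepro2.M9PocketProdWsideFamT
import Summits.Ventures.PercRepro2.M9PocketProdAssemblyT

/-!
# [`T`-edge chain] The `K`-only legal sum with a defect-weighted fibre constant (blind cell
PercRepro2, p3 g42, 2026-08-30; `proofs/P3-POCKETRK.md` §10⁶ (b)–(d): the outside half of the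
`{r, s, d}`-cluster type calculus)

`M9PocketProdAssemblyT` sums `σ_pq · σ_rs` over the `HD` points with `d ∈ K₂`.  The type
calculus of a cluster hanging from `{r, s, d}` needs the SAME product fibres with a different
summand: the sum over ALL `K`-only legal points (`Sep ∧ DOne ∧ d ∈ K₂ ∖ M₂`) of
`(a(σ_rs) + [W-defect] · b(σ_rs)) · σ_pq`, for any `a, b ≥ 0` on `{0, 1}` — the weight that the
colourings of the cluster produce once they are summed out (`a`, `b` are counts of admissible
cluster colourings).  On a product fibre `σ_rs` is constant in `{0, 1}` (`sigma_rs_prod_eq_T`,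
`sigma_rs_nonneg_of_noWside_T`), the defect is antitone (`wdefect_prod_anti_T`) and `p ~_Y q`
monotone (`conn_prod_mono_T`, `conn_compl_prod_of_conn_compl_T`), so the cube Harris
(`sum_cube_weight_mul_sigma_pq_nonpos`) gives `Σ_S (a + [defect] b) · σ_pq(φ S) ≤ 0`
(`sum_prod_fibre_weight_nonpos_T`); the fibre over a skeleton is in bijection with the cube
(`prod_index_eq_T`, `index_prod_iff_T`, `skel_prod_eq_T`), so the sum over the fibre is `≤ 0`
(`sum_skel_fibre_weight_nonpos_T`), and the skeleton map partitions the `K`-only legal points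
(`skel_legal_T`): `sum_konly_weight_nonpos_T`.  No hypothesis on `p, q` (for `p = d` or `q = d`
the `K`-only legal set is empty, `konly_empty_of_eq_p3`).  Own work; std axioms.
-/

namespace Summit.Ventures.PercRepro2

namespace NoPocket

open Finset Classical OneColourSwitch SideSwitch

variable {V : Type*} {E : Type*} {ends : E → Sym2 V} {p q r s d : V} {ρ : Config E}
  {𝔉 : Finset (Finset V)} {R : Finset E}

section Fibre

/-- **The defect-weighted sum of a product fibre is non-positive**: for constants `a, b ≥ 0`,
`Σ_S (a + [W-defect at φ S] · b) · σ_pq(φ S) ≤ 0` — the cube Harris with the antitone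
non-negative weight `a + [defect] b`. -/
theorem sum_prod_fibre_weight_nonpos_T (hdr : d ≠ r) (hds : d ≠ s)
    (hrs : within ends ({r, s} : Set V) = ∅)
    (hM : d ∉ M2 ends r s ρ)
    (hsep : sep2 ends p q r s ρ) (hD : DOne ends r s d ρ) (hK : d ∈ K2 ends r s ρ)
    (hB : ∀ x ∈ M2 (endsD ends d) r s ρ, x = r ∨ x = s)
    (hR : ∀ e, e ∈ R ↔ e ∉ touches ends (cluster ends ρ d ∪ K2 (endsD ends d) r s ρ ∪
      M2 (endsD ends d) r s ρ))
    (h𝔉K : ∀ C ∈ 𝔉, (↑C : Set V) ⊆ K2 (endsD ends d) r s ρ)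
    (h𝔉r : ∀ C ∈ 𝔉, r ∉ C) (h𝔉s : ∀ C ∈ 𝔉, s ∉ C)
    (h𝔉cl : ∀ C ∈ 𝔉, ClosedIn (endsD ends d) (sided (endsD ends d) r s ρ) (↑C : Set V))
    (h𝔉d : ∀ C ∈ 𝔉, ∀ e y, y ∈ C → ends e ≠ s(d, y))
    (h𝔉pk : ∀ C ∈ 𝔉, ∀ e x y, ends e = s(x, y) → x ∈ C → y ∈ cluster ends ρ d →
      y ∈ C ∨ y = r ∨ y = s)
    (hdisj : ∀ C ∈ 𝔉, ∀ C' ∈ 𝔉, C ≠ C' → Disjoint C C')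
    (a b : ℤ) (ha : 0 ≤ a) (hb : 0 ≤ b) :
    ∑ S : Finset ({C // C ∈ 𝔉} ⊕ {e // e ∈ R}),
      (a + (if WDefect ends p q r s d (flipTouch (endsD ends d)
          {x : V | ∃ c : {C // C ∈ 𝔉}, Sum.inl c ∈ S ∧ x ∈ c.1}
          (fun e => if h : e ∈ R then decide (Sum.inr ⟨e, h⟩ ∈ S) else ρ e)) then b else 0)) *
        sigma ends (flipTouch (endsD ends d)
          {x : V | ∃ c : {C // C ∈ 𝔉}, Sum.inl c ∈ S ∧ x ∈ c.1}
          (fun e => if h : e ∈ R then decide (Sum.inr ⟨e, h⟩ ∈ S) else ρ e)) p q ≤ 0 := by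
  set φ : Finset ({C // C ∈ 𝔉} ⊕ {e // e ∈ R}) → Config E := fun S => flipTouch (endsD ends d)
    {x : V | ∃ c : {C // C ∈ 𝔉}, Sum.inl c ∈ S ∧ x ∈ c.1}
    (fun e => if h : e ∈ R then decide (Sum.inr ⟨e, h⟩ ∈ S) else ρ e) with hφ
  set H : Finset ({C // C ∈ 𝔉} ⊕ {e // e ∈ R}) → ℤ := fun S =>
    a + (if WDefect ends p q r s d (φ S) then b else 0) with hH
  have hY : ∀ S T : Finset ({C // C ∈ 𝔉} ⊕ {e // e ∈ R}), S ⊆ T →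
      Conn ends (φ S) p q → Conn ends (φ T) p q := fun S T hST h =>
    conn_prod_mono_T hdr hds hrs hM hsep hD hK hB hR h𝔉K h𝔉r h𝔉s h𝔉cl h𝔉d h𝔉pk S hST h
  have hpair : ∀ S : Finset ({C // C ∈ 𝔉} ⊕ {e // e ∈ R}), Conn ends (φ Sᶜ) p q →
      Conn ends (OneColourSwitch.compl (φ S)) p q := fun S h =>
    conn_compl_prod_of_conn_compl_T hdr hds hrs hM hsep hD hK hB hR h𝔉K h𝔉r h𝔉s h𝔉cl h𝔉d h𝔉pk
      hdisj S h
  have hHanti : Antitone H := by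
    intro S S' hSS
    simp only [hH]
    by_cases h' : WDefect ends p q r s d (φ S')
    · rw [if_pos h', if_pos (wdefect_prod_anti_T hdr hds hrs hM hsep hD hK hB hR h𝔉K h𝔉r h𝔉s
        h𝔉cl h𝔉d h𝔉pk hSS h')]
    · rw [if_neg h']
      split_ifs <;> linarith
  have hH0 : ∀ S, 0 ≤ H S := by
    intro S
    simp only [hH]
    split_ifs <;> linarith
  exact sum_cube_weight_mul_sigma_pq_nonpos φ hY hpair H hHanti hH0

end Fibre

section Skel

variable [Fintype V] [DecidableEq V] [Fintype E] [DecidableEq E]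

omit [Fintype V] [DecidableEq V] [Fintype E] [DecidableEq E] in
/-- **Transfer along a bijection of a fibre with a cube**: a weighted cube sum `Σ_S w S · σ_pq(φ S)`
that is non-positive gives a non-positive fibre sum when `φ` is a bijection from the cube onto the
fibre (inverse `idx`) and the fibre summand agrees with the cube summand along `φ`. -/
theorem sum_fibre_weight_le_of_bij {ι : Type*} [Fintype ι] [DecidableEq ι]
    {F : Finset (Config E)} {φ : Finset ι → Config E} {w : Finset ι → ℤ}
    (key : ∑ S : Finset ι, w S * sigma ends (φ S) p q ≤ 0)
    (f : Config E → ℤ) (idx : Config E → Finset ι)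
    (hpt : ∀ ω ∈ F, φ (idx ω) = ω) (hidx : ∀ S, idx (φ S) = S) (hmem : ∀ S, φ S ∈ F)
    (hf : ∀ S, f (φ S) = w S * sigma ends (φ S) p q) :
    ∑ ω ∈ F, f ω ≤ 0 := by
  refine le_trans (le_of_eq ?_) key
  refine Finset.sum_nbij' idx φ ?_ ?_ ?_ ?_ ?_
  · intro ω _
    exact Finset.mem_univ _
  · intro S _
    exact hmem S
  · intro ω hω
    exact hpt ω hω
  · intro S _
    exact hidx S
  · intro ω hω
    rw [← hf (idx ω), hpt ω hω]

/-- **The defect-weighted sum over the `K`-only legal points with skeleton `ρ` is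
non-positive**: the fibre is the product fibre of `ρ`, on which `σ_rs` is the constant
`σ_rs(ρ) ∈ {0, 1}`. -/
theorem sum_skel_fibre_weight_nonpos_T (hdr : d ≠ r) (hds : d ≠ s)
    (hrs : within ends ({r, s} : Set V) = ∅)
    (hp : p ≠ d) (hq : q ≠ d) {ρ : Config E}
    (hsep : sep2 ends p q r s ρ) (hD : DOne ends r s d ρ) (hK : d ∈ K2 ends r s ρ)
    (hM : d ∉ M2 ends r s ρ)
    (hB : ∀ x ∈ M2 (endsD ends d) r s ρ, x = r ∨ x = s)
    (hρR : ∀ e ∉ touches ends (cluster ends ρ d ∪ K2 (endsD ends d) r s ρ ∪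
      M2 (endsD ends d) r s ρ), ρ e = false)
    (hnl : ∀ C ∈ comps (endsD ends d) r s ρ, (∀ e y, y ∈ C → ends e ≠ s(d, y)) →
      (∀ e y, y ∈ C → ends e ≠ s(r, y)) ∨ (∀ e y, y ∈ C → ends e ≠ s(s, y)))
    (a b : ℤ → ℤ) (ha : ∀ σ, 0 ≤ σ → 0 ≤ a σ) (hb : ∀ σ, 0 ≤ σ → 0 ≤ b σ) :
    ∑ ω ∈ (univ.filter (fun ω : Config E => sep2 ends p q r s ω ∧ DOne ends r s d ω ∧
        d ∈ K2 ends r s ω ∧ d ∉ M2 ends r s ω)).filter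
        (fun ω => (fun e => if e ∈ touches ends
          (cluster ends (flipTouch (endsD ends d)
              {x : V | x ∈ M2 (endsD ends d) r s ω ∧ x ≠ r ∧ x ≠ s} ω) d ∪
            K2 (endsD ends d) r s (flipTouch (endsD ends d)
              {x : V | x ∈ M2 (endsD ends d) r s ω ∧ x ≠ r ∧ x ≠ s} ω) ∪
            M2 (endsD ends d) r s (flipTouch (endsD ends d)
              {x : V | x ∈ M2 (endsD ends d) r s ω ∧ x ≠ r ∧ x ≠ s} ω)) then
          flipTouch (endsD ends d) {x : V | x ∈ M2 (endsD ends d) r s ω ∧ x ≠ r ∧ x ≠ s} ω e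
          else false) = ρ),
      (a (sigma ends ω r s) + (if WDefect ends p q r s d ω then b (sigma ends ω r s) else 0)) *
        sigma ends ω p q ≤ 0 := by
  have hR := mem_R_iff (ends := ends) (r := r) (s := s) (d := d) (ρ := ρ)
  have h𝔉K := fam_subset_K2 (ends := ends) (d := d) hB
  have hrs0 : 0 ≤ sigma ends ρ r s := sigma_rs_nonneg_of_noWside_T hdr hds hrs hM hB
  have key := sum_prod_fibre_weight_nonpos_T (p := p) (q := q) hdr hds hrs hM hsep hD hK hB hR
    h𝔉K fam_notMem_r fam_notMem_s fam_closedIn fam_free fam_pocket fam_disjoint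
    (a (sigma ends ρ r s)) (b (sigma ends ρ r s)) (ha _ hrs0) (hb _ hrs0)
  refine sum_fibre_weight_le_of_bij key _ (fun ω => univ.filter (fun i =>
    (∀ c, i = Sum.inl c →
      (↑c.1 : Set V) ⊆ {x : V | x ∈ M2 (endsD ends d) r s ω ∧ x ≠ r ∧ x ≠ s}) ∧
    ∀ e, i = Sum.inr e → ω e.1 = true)) ?_ ?_ ?_ ?_
  · intro ω hω
    rw [Finset.mem_filter, Finset.mem_filter] at hω
    obtain ⟨⟨_, hsepω, hDω, hKω, hMω⟩, hρω⟩ := hω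
    exact prod_index_eq_T hdr hds hsepω hDω hKω hMω hp hq hρω.symm hR h𝔉K
      (wside_block_mem_fam_T hdr hds hsepω hDω hKω hMω hρω.symm) _
      (fun i => Finset.mem_filter.trans (and_iff_right (Finset.mem_univ i)))
  · intro S
    ext i
    exact (Finset.mem_filter.trans (and_iff_right (Finset.mem_univ i))).trans
      (index_prod_iff_T hdr hds hrs hM hsep hB hR h𝔉K fam_notMem_r fam_notMem_s fam_closedIn
        fam_disjoint fam_nonempty S i).symm
  · intro S
    rw [Finset.mem_filter, Finset.mem_filter]
    refine ⟨⟨Finset.mem_univ _, sep2_prod_T hdr hds hrs hM hsep hD hK hB hR h𝔉K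
      fam_notMem_r fam_notMem_s fam_closedIn fam_free fam_pocket S hp hq,
      DOne_prod_T hdr hds hrs hM hsep hD hB hR h𝔉K fam_notMem_r fam_notMem_s fam_closedIn
        fam_free fam_pocket S,
      d_mem_K2_prod_T hdr hds hrs hM hsep hK hB hR h𝔉K fam_notMem_r fam_notMem_s fam_closedIn
        fam_free S,
      d_notMem_M2_prod_T hdr hds hrs hM hsep hB hR h𝔉K fam_notMem_r fam_notMem_s fam_closedIn
        fam_free S⟩, ?_⟩
    exact skel_prod_eq_T hdr hds hrs hM hsep hB hρR hR h𝔉K fam_notMem_r fam_notMem_s fam_closedIn S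
  · intro S
    rw [sigma_rs_prod_eq_T hdr hds hrs hM hsep hD hK hB hR h𝔉K fam_notMem_r fam_notMem_s
      fam_closedIn fam_free fam_pocket (fam_nl_of hnl) S]

/-- **The defect-weighted `K`-only legal sum is non-positive** when no free block of `G − d`
is adjacent to both `r` and `s`: partition by the skeleton. -/
theorem sum_konly_weight_nonpos_T (hdr : d ≠ r) (hds : d ≠ s)
    (hrs : within ends ({r, s} : Set V) = ∅)
    (hp : p ≠ d) (hq : q ≠ d)
    (hnl : ∀ ρ : Config E, ∀ C ∈ comps (endsD ends d) r s ρ,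
      (∀ e y, y ∈ C → ends e ≠ s(d, y)) →
      (∀ e y, y ∈ C → ends e ≠ s(r, y)) ∨ (∀ e y, y ∈ C → ends e ≠ s(s, y)))
    (a b : ℤ → ℤ) (ha : ∀ σ, 0 ≤ σ → 0 ≤ a σ) (hb : ∀ σ, 0 ≤ σ → 0 ≤ b σ) :
    (∑ ω : Config E, if sep2 ends p q r s ω ∧ DOne ends r s d ω ∧ d ∈ K2 ends r s ω ∧
        d ∉ M2 ends r s ω then
      (a (sigma ends ω r s) + (if WDefect ends p q r s d ω then b (sigma ends ω r s) else 0)) *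
        sigma ends ω p q else 0) ≤ 0 := by
  rw [← Finset.sum_filter]
  have hmaps : ∀ ω ∈ univ.filter (fun ω : Config E => sep2 ends p q r s ω ∧ DOne ends r s d ω ∧
      d ∈ K2 ends r s ω ∧ d ∉ M2 ends r s ω),
      (fun e => if e ∈ touches ends
          (cluster ends (flipTouch (endsD ends d)
              {x : V | x ∈ M2 (endsD ends d) r s ω ∧ x ≠ r ∧ x ≠ s} ω) d ∪
            K2 (endsD ends d) r s (flipTouch (endsD ends d)
              {x : V | x ∈ M2 (endsD ends d) r s ω ∧ x ≠ r ∧ x ≠ s} ω) ∪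
            M2 (endsD ends d) r s (flipTouch (endsD ends d)
              {x : V | x ∈ M2 (endsD ends d) r s ω ∧ x ≠ r ∧ x ≠ s} ω)) then
          flipTouch (endsD ends d) {x : V | x ∈ M2 (endsD ends d) r s ω ∧ x ≠ r ∧ x ≠ s} ω e
          else false) ∈ univ.filter (fun ρ : Config E =>
        sep2 ends p q r s ρ ∧ DOne ends r s d ρ ∧ d ∈ K2 ends r s ρ ∧ d ∉ M2 ends r s ρ ∧
          (∀ x ∈ M2 (endsD ends d) r s ρ, x = r ∨ x = s) ∧
          ∀ e ∉ touches ends (cluster ends ρ d ∪ K2 (endsD ends d) r s ρ ∪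
            M2 (endsD ends d) r s ρ), ρ e = false) := by
    intro ω hω
    rw [Finset.mem_filter] at hω
    obtain ⟨_, hsep, hD, hK, hM⟩ := hω
    rw [Finset.mem_filter]
    refine ⟨Finset.mem_univ _, ?_⟩
    obtain ⟨h1, h2, h3, h4, h5, -, h7⟩ := skel_legal_T hdr hds hrs hsep hD hK hM hp hq
    exact ⟨h1, h2, h3, h4, h5, h7⟩
  rw [← Finset.sum_fiberwise_of_maps_to hmaps]
  refine Finset.sum_nonpos fun ρ hρ => ?_
  rw [Finset.mem_filter] at hρ
  obtain ⟨_, hsep, hD, hK, hM, hB, hρR⟩ := hρ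
  exact sum_skel_fibre_weight_nonpos_T hdr hds hrs hp hq hsep hD hK hM hB hρR (hnl ρ) a b ha hb

omit [Fintype V] [DecidableEq V] in
/-- With `p = d` or `q = d` there is no `K`-only legal point (`Sep` separates `p`, `q` from
`r`, `s`): the defect-weighted sum vanishes. -/
lemma konly_sum_eq_zero_of_eq_p3 (h : p = d ∨ q = d) (f : Config E → ℤ) :
    (∑ ω : Config E, if sep2 ends p q r s ω ∧ DOne ends r s d ω ∧ d ∈ K2 ends r s ω ∧
        d ∉ M2 ends r s ω then f ω else 0) = 0 := by
  refine Finset.sum_eq_zero fun ω _ => ?_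
  rw [if_neg]
  rintro ⟨hsep, -, hK, -⟩
  rcases mem_K2_iff.1 hK with hc | hc
  · rcases h with h | h
    · exact hsep.1.1 (h ▸ conn_symm hc)
    · exact hsep.1.2.2.1 (h ▸ conn_symm hc)
  · rcases h with h | h
    · exact hsep.1.2.1 (h ▸ conn_symm hc)
    · exact hsep.1.2.2.2 (h ▸ conn_symm hc)

/-- **The defect-weighted `K`-only legal sum is non-positive, no hypothesis on `p`, `q`.** -/
theorem sum_konly_weight_nonpos_T' (hdr : d ≠ r) (hds : d ≠ s)
    (hrs : within ends ({r, s} : Set V) = ∅)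
    (hnl : ∀ ρ : Config E, ∀ C ∈ comps (endsD ends d) r s ρ,
      (∀ e y, y ∈ C → ends e ≠ s(d, y)) →
      (∀ e y, y ∈ C → ends e ≠ s(r, y)) ∨ (∀ e y, y ∈ C → ends e ≠ s(s, y)))
    (a b : ℤ → ℤ) (ha : ∀ σ, 0 ≤ σ → 0 ≤ a σ) (hb : ∀ σ, 0 ≤ σ → 0 ≤ b σ) :
    (∑ ω : Config E, if sep2 ends p q r s ω ∧ DOne ends r s d ω ∧ d ∈ K2 ends r s ω ∧
        d ∉ M2 ends r s ω then
      (a (sigma ends ω r s) + (if WDefect ends p q r s d ω then b (sigma ends ω r s) else 0)) *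
        sigma ends ω p q else 0) ≤ 0 := by
  by_cases h : p = d ∨ q = d
  · rw [konly_sum_eq_zero_of_eq_p3 h]
  · rw [not_or] at h
    exact sum_konly_weight_nonpos_T hdr hds hrs h.1 h.2 hnl a b ha hb

end Skel

end NoPocket

end Summit.Ventures.PercRepro2
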